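import Literature.AlgebraicGeometry.Resolution.RegularLocalRingsQuotient
import HarnessLib

/-!
# [OURS · L1 W4.5(b)] EL♮ helper H-COMB, part 5 — the comb centre in LOCAL-RING form (stalk currency)

Support file of the crux chain w45b (cell `res-hironaka`, LADDER-RESOLUTION rung L, slot W4.5(b)), working crux
**EL♮ = `EquisingularLiftNat`** (stmt-ResolutionOfSingularities-20038; bookkeeping node stmt-ResolutionOfSingularities-15660),
research stub `stub_elnat_three(_horiz/_isolated)` of line `sections`; res-L1-w45b-tri-1's typable core
**`comb_centre_regular`** in its coordinate-free wording (TRIAGE v4 §−4.B «`R` regular local, `X, t` part of a regular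
system, `u` unit, `ϖ` regular parameter ⇒ `R/(Xt − ϖu)` regular with reduced special fibre `V(X) ∪ V(t)`», the comb
`C_a` of the `H_F` schedule, CRUX-PLAN v3 §1.7), complementing the chart-polynomial form of parts 1–2
(`…EquisingularLiftNatAdaptedEquation` / `…EquisingularLiftNatCombCentre`): this is the version that applies
DIRECTLY to a stalk `𝒪_{P,x}` of the blown-up carrier / ambient (a regular local ring, not a polynomial ring), as the
scheme-level assembly (`Scheme.IsRegular` = all stalks regular) wants. Pattern and tools of
`Theorems/EquisingularLiftEquisingularLiftLinkedNode.lean` / `…RegularLiftOfNotDvd.lean` (Matsumura 14.2, tree theorem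
`IsRegularLocalRing.quotient_span_singleton`). Filed `--supports stmt-ResolutionOfSingularities-20038` by
res-L1-w45b-stub-3. OURS, elementary; replaces the role of NOTHING in H. Hironaka's manuscript and is NOT a statement
of it. AI review is weaker than expert review.

* `isRegularLocalRing_quotient_comb` — `(R, 𝔪)` regular local, `ϖ ∈ 𝔪 ∖ 𝔪²`, `X, t ∈ 𝔪`, `u ∈ Rˣ` ⇒ `R/(X·t − ϖ·u)` is a
  regular local ring of dimension `dim R − 1` (the comb equation is a regular PARAMETER: `X·t ∈ 𝔪²`, `ϖ·u ∉ 𝔪²`);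
* `varpi_not_mem_span_comb` — moreover `ϖ ∉ (X·t − ϖ·u)` as soon as `X ∈ 𝔪`, `X, t ∉ (ϖ)` (no vertical component: the centre
  is `O`-flat at the point; `ϖ` is prime by Matsumura 14.3);
* `span_comb_sup_span_X_eq`, `span_comb_sup_span_varpi_eq` — the two traces as ideal identities: `(X·t − ϖ·u, X) = (ϖ, X)` (the
  tooth `e = V(ϖ, X)` lies on the centre and is its whole intersection with `E = V(X)`) and
  `(X·t − ϖ·u, ϖ) = (ϖ, X·t)` (special fibre = `V(X) ∪ V(t)` inside `V(ϖ)`, the reduced node when `X, t` are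
  independent parameters modulo `ϖ`).

References: H. Matsumura, *Commutative Ring Theory*, CUP 1986, Thms. 14.2, 14.3 (context; the statements are
folklore).
-/

set_option linter.dupNamespace false -- mandated namespace of this single-conjunct summit

namespace Summit.ResolutionOfSingularities.ResolutionOfSingularities.Theorems.EquisingularLiftNat.CombCentre

open IsLocalRing Literature.AlgebraicGeometry.Resolution

variable {R : Type*} [CommRing R]

/-- **Comb centre, local form** (tri-1 TRIAGE v4 §−4.B core `comb_centre_regular`, coordinate-free). In a regular local
ring `(R, 𝔪)` let `ϖ ∈ 𝔪 ∖ 𝔪²` (the uniformizer is a regular parameter: a GOOD point), `X, t ∈ 𝔪` and `u` a unit. Then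
`R/(X·t − ϖ·u)` is a regular local ring and `dim R/(X·t − ϖ·u) + 1 = dim R`: the comb equation `X·t − ϖ·u` lies in
`𝔪 ∖ 𝔪²` (`X·t ∈ 𝔪²`, `ϖ·u ∉ 𝔪²`), Matsumura 14.2. [folklore] -/
theorem isRegularLocalRing_quotient_comb [IsRegularLocalRing R] {ϖ X t : R} (u : Rˣ)
    (hϖ : ϖ ∈ maximalIdeal R) (hϖ2 : ϖ ∉ maximalIdeal R ^ 2) (hX : X ∈ maximalIdeal R)
    (ht : t ∈ maximalIdeal R) :
    IsRegularLocalRing (R ⧸ Ideal.span {X * t - ϖ * u}) ∧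
      ringKrullDim (R ⧸ Ideal.span {X * t - ϖ * u}) + 1 = ringKrullDim R := by
  refine IsRegularLocalRing.quotient_span_singleton ?_ ?_
  · exact sub_mem (Ideal.mul_mem_right _ _ hX) (Ideal.mul_mem_right _ _ hϖ)
  · intro hmem
    apply hϖ2
    have hXt : X * t ∈ maximalIdeal R ^ 2 := by
      rw [pow_two]; exact Ideal.mul_mem_mul hX ht
    have h1 : ϖ * u ∈ maximalIdeal R ^ 2 := by
      have := sub_mem hXt hmem
      rwa [sub_sub_cancel] at this
    have h2 : ϖ * u * ↑u⁻¹ ∈ maximalIdeal R ^ 2 := Ideal.mul_mem_right _ _ h1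
    rwa [Units.mul_inv_cancel_right] at h2

/-- **No vertical component at the point.** In a regular local ring with `ϖ ∈ 𝔪 ∖ 𝔪²` (so `ϖ` is a prime element,
Matsumura 14.3), `X ∈ 𝔪` and `X, t ∉ (ϖ)`, the uniformizer does not lie in the comb ideal: `ϖ ∉ (X·t − ϖ·u)`. Hence
`ϖ ≠ 0` in the domain `R/(X·t − ϖ·u)`: the comb centre is `O`-flat at this point. (If `ϖ = a(Xt − ϖu)`: for `a` a unit
`Xt ∈ (ϖ)`, contradicting primality; for `a ∈ 𝔪`, `ϖ(1 + au) = aXt ∈ 𝔪²` with `1 + au` a unit.) [folklore] -/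
theorem varpi_not_mem_span_comb [IsRegularLocalRing R] {ϖ X t : R} (u : Rˣ)
    (hϖ : ϖ ∈ maximalIdeal R) (hϖ2 : ϖ ∉ maximalIdeal R ^ 2) (hXm : X ∈ maximalIdeal R)
    (hX : X ∉ Ideal.span {ϖ}) (ht : t ∉ Ideal.span {ϖ}) : ϖ ∉ Ideal.span {X * t - ϖ * u} := by
  intro hmem
  obtain ⟨a, ha⟩ := Ideal.mem_span_singleton'.mp hmem
  have hprime : Prime ϖ := IsRegularLocalRing.prime_of_not_mem_sq hϖ hϖ2
  have key : a * (X * t) = ϖ * (1 + a * u) := by linear_combination ha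
  by_cases hau : IsUnit a
  · -- `a` a unit: `X·t ∈ (ϖ)`, so `ϖ ∣ X` or `ϖ ∣ t`
    obtain ⟨v, rfl⟩ := hau
    have hv : (↑v⁻¹ : R) * ↑v = 1 := Units.inv_mul v
    have hdvd : ϖ ∣ X * t :=
      ⟨↑v⁻¹ * (1 + ↑v * ↑u), by linear_combination (↑v⁻¹ : R) * key - (X * t) * hv⟩
    rcases hprime.dvd_or_dvd hdvd with h | h
    · exact hX (Ideal.mem_span_singleton.mpr h)
    · exact ht (Ideal.mem_span_singleton.mpr h)
  · -- `a ∈ 𝔪`: `ϖ·(1 + a u) = a·X·t ∈ 𝔪²` and `1 + a u` is a unit, so `ϖ ∈ 𝔪²`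
    have ham : a ∈ maximalIdeal R := (IsLocalRing.mem_maximalIdeal _).mpr hau
    have h1 : ϖ * (1 + a * u) ∈ maximalIdeal R ^ 2 := by
      rw [← key, pow_two]
      exact Ideal.mul_mem_mul ham (Ideal.mul_mem_right _ _ hXm)
    have hunit : IsUnit (1 + a * u) := by
      have h' := IsLocalRing.isUnit_one_sub_self_of_mem_nonunits (-(a * ↑u))
        ((IsLocalRing.mem_maximalIdeal _).mp ((maximalIdeal R).neg_mem (Ideal.mul_mem_right _ _ ham)))
      rwa [sub_neg_eq_add] at h'
    obtain ⟨w, hw⟩ := hunit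
    apply hϖ2
    have h2 : ϖ * (1 + a * u) * ↑w⁻¹ ∈ maximalIdeal R ^ 2 := Ideal.mul_mem_right _ _ h1
    rwa [← hw, Units.mul_inv_cancel_right] at h2

/-- **Trace on the exceptional divisor, local form**: `(X·t − ϖ·u, X) = (ϖ, X)` — modulo `X` the comb equation is the
uniformizer up to a unit: the tooth `e = V(ϖ, X)` lies on the comb centre and is exactly its intersection with
`E = V(X)`. [folklore] -/
theorem span_comb_sup_span_X_eq {ϖ X t : R} (u : Rˣ) :
    Ideal.span {X * t - ϖ * u} ⊔ Ideal.span {X} = Ideal.span {ϖ} ⊔ Ideal.span {X} := by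
  rw [← Ideal.span_insert, ← Ideal.span_insert]
  have hu : (↑u⁻¹ : R) * ↑u = 1 := Units.inv_mul u
  apply le_antisymm
  · rw [Ideal.span_le, Set.insert_subset_iff, Set.singleton_subset_iff]
    refine ⟨Ideal.mem_span_pair.mpr ⟨-(u : R), t, by ring⟩, Ideal.subset_span (by simp)⟩
  · rw [Ideal.span_le, Set.insert_subset_iff, Set.singleton_subset_iff]
    refine ⟨Ideal.mem_span_pair.mpr ⟨-(↑u⁻¹ : R), ↑u⁻¹ * t, ?_⟩, Ideal.subset_span (by simp)⟩
    linear_combination ϖ * hu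

/-- **Special fibre, local form**: `(X·t − ϖ·u, ϖ) = (ϖ, X·t)` — modulo `ϖ` the comb centre is `V(X·t) = V(X) ∪ V(t)`,
the reduced node `e ∪ ℓ′` when `X, t` are independent parameters modulo `ϖ`. [folklore] -/
theorem span_comb_sup_span_varpi_eq {ϖ X t : R} (u : Rˣ) :
    Ideal.span {X * t - ϖ * u} ⊔ Ideal.span {ϖ} = Ideal.span {ϖ} ⊔ Ideal.span {X * t} := by
  rw [← Ideal.span_insert, ← Ideal.span_insert]
  apply le_antisymm
  · rw [Ideal.span_le, Set.insert_subset_iff, Set.singleton_subset_iff]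
    refine ⟨Ideal.mem_span_pair.mpr ⟨-(u : R), 1, by ring⟩, Ideal.subset_span (by simp)⟩
  · rw [Ideal.span_le, Set.insert_subset_iff, Set.singleton_subset_iff]
    refine ⟨Ideal.subset_span (by simp), Ideal.mem_span_pair.mpr ⟨1, (u : R), by ring⟩⟩

end Summit.ResolutionOfSingularities.ResolutionOfSingularities.Theorems.EquisingularLiftNat.CombCentre
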